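import Mathlib
import Summits.Ventures.PercRepro2.SkeletonPath
import Summits.Ventures.PercRepro2.SkeletonClasses

/-!
# The pendant path into a hub, re-derived from the reduction relation (blind cell PercRepro2,
night-1 g16; NIGHT1-G16.md §4)

`StarH.HMF_pendant_path_any` (g15, 322 lines: a bespoke induction re-verifying eight fields per step)
is a composition of two landed reductions: the path `a₃ = vs 0 – … – vs k = u` contracts onto its
first edge (`Skeleton.reduces_of_isPath`), and the reduct is a leaf at a marks / whiskers hub
(`Skeleton.HMF_of_reduces_leaf_hub`).  **`HMF_pendant_path_hub`** / **`HCov_pendant_path_hub`**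
state the class on the nonzero edges of the original instance: every class theorem of the S-table
is closed under the subdivision of its edges, and the subdivision is handled by the relation, not by
the class.

Own code; standard axioms.
-/

open scoped Classical

namespace Summit.Ventures.PercRepro2

open UnionCluster CovForm

namespace Skeleton

section PathHub

variable {V : Type*} {E : Type*} [Fintype E] [DecidableEq E] [Fintype V] [DecidableEq V]
  {R : Type*} [Field R] [LinearOrder R] [IsStrictOrderedRing R]

variable {o a₁ a₂ a₃ b : V}

omit [Fintype E] [Fintype V] [DecidableEq V] [LinearOrder R] [IsStrictOrderedRing R] in
/-- The contracted weight of the first path edge is the product of the path weights. -/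
lemma pathWeight_first (p : E → R) (es : ℕ → E) (k : ℕ) :
    pathWeight p es k (es 0) = ∏ i ∈ Finset.range k, p (es i) := by
  unfold pathWeight; simp

omit [Fintype E] [Fintype V] [DecidableEq V] [LinearOrder R] [IsStrictOrderedRing R] in
/-- An edge of nonzero contracted weight other than the first path edge is not a path edge and has
nonzero weight. -/
lemma of_pathWeight_ne_zero (p : E → R) (es : ℕ → E) (k : ℕ) {e : E} (he0 : e ≠ es 0)
    (he : pathWeight p es k e ≠ 0) : (∀ i, 0 < i → i < k → e ≠ es i) ∧ p e ≠ 0 := by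
  unfold pathWeight at he
  rw [if_neg he0] at he
  by_cases hex : ∃ i, 0 < i ∧ i < k ∧ e = es i
  · rw [if_pos hex] at he; exact absurd rfl he
  · rw [if_neg hex] at he
    exact ⟨fun i hi0 hi hh => hex ⟨i, hi0, hi, hh⟩, he⟩

/-- **The pendant path of any length into a marks / whiskers hub**, on the nonzero edges: `a₃ = vs 0`
is joined to the unmarked hub `u = vs k` by a path of nonzero edges through unmarked vertices of
nonzero-degree two (`IsPath`), `a₃` carries no other nonzero edge, and every nonzero edge at `u` other
than the last path edge joins `u` to a mark or to an unmarked whisker.  Then (HMF). -/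
theorem HMF_pendant_path_hub (p : E → R) (ends : E → Sym2 V) (hp : IsProbVec p) (k : ℕ)
    (vs : ℕ → V) (es : ℕ → E) (h : IsPath p ends o a₁ a₂ a₃ b k vs es) (h0 : vs 0 = a₃)
    (hleaf : ∀ e, p e ≠ 0 → a₃ ∈ ends e → e = es 0)
    (hu : ∀ e, p e ≠ 0 → vs k ∈ ends e → e = es (k - 1) ∨
      ends e = s(vs k, a₁) ∨ ends e = s(vs k, a₂) ∨ ends e = s(vs k, o) ∨ ends e = s(vs k, b) ∨
      ∃ y, ends e = s(vs k, y) ∧ y ≠ vs k ∧ y ≠ o ∧ y ≠ a₁ ∧ y ≠ a₂ ∧ y ≠ a₃ ∧ y ≠ b ∧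
        ∀ e', p e' ≠ 0 → y ∈ ends e' → e' = e)
    (h3o : a₃ ≠ o) (h31 : a₃ ≠ a₁) (h32 : a₃ ≠ a₂) (h3b : a₃ ≠ b)
    (hu1 : vs k ≠ a₁) (hu2 : vs k ≠ a₂) (huo : vs k ≠ o) (hub : vs k ≠ b) :
    HMF p ends o a₁ a₂ a₃ b := by
  have hred := reduces_of_isPath p ends hp k vs es h
  rw [h0] at hred
  have h3u : a₃ ≠ vs k := by
    intro hh
    have := h.vs_inj 0 k (by omega) le_rfl (by rw [h0, hh])
    have := h.pos; omega
  have hprod : pathWeight p es k (es 0) ≠ 0 := by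
    rw [pathWeight_first]
    exact Finset.prod_ne_zero_iff.2 fun i hi => h.nz i (Finset.mem_range.1 hi)
  refine HMF_of_reduces_leaf_hub hp hred (f := es 0) (u := vs k) (by simp) hprod ?_ ?_ h3u h3o h31
    h32 h3b hu1 hu2 huo hub
  · -- the only nonzero edge at `a₃` in the reduct is the contracted edge
    intro e he hae
    by_contra hne
    obtain ⟨_, hpe⟩ := of_pathWeight_ne_zero p es k hne he
    rw [Function.update_of_ne hne] at hae
    exact hne (hleaf e hpe hae)
  · -- the nonzero edges at the hub in the reduct
    intro e he hue
    by_cases hne : e = es 0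
    · subst hne; left; simp only [Function.update_self]; exact Sym2.eq_swap
    · obtain ⟨hnot, hpe⟩ := of_pathWeight_ne_zero p es k hne he
      rw [Function.update_of_ne hne] at hue ⊢
      rcases hu e hpe hue with hk | hh | hh | hh | hh | ⟨y, hy, hyu, hyo, hy1, hy2, hy3, hyb, hwh⟩
      · -- the last path edge: it is the contracted edge (`k = 1`) or an interior path edge (zeroed)
        exfalso
        by_cases hk1 : k = 1
        · subst hk1; exact hne (by simpa using hk)
        · exact hnot (k - 1) (by have := h.pos; omega) (by have := h.pos; omega) hk
      · exact Or.inr (Or.inl hh)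
      · exact Or.inr (Or.inr (Or.inl hh))
      · exact Or.inr (Or.inr (Or.inr (Or.inl hh)))
      · exact Or.inr (Or.inr (Or.inr (Or.inr (Or.inl hh))))
      · refine Or.inr (Or.inr (Or.inr (Or.inr (Or.inr ⟨y, hy, hyu, hyo, hy1, hy2, hy3, hyb, ?_⟩))))
        intro e' he' hye'
        by_cases hne' : e' = es 0
        · exfalso
          subst hne'
          rw [Function.update_self] at hye'
          rcases Sym2.mem_iff.1 hye' with hh | hh
          · exact hy3 hh
          · exact hyu hh
        · obtain ⟨_, hpe'⟩ := of_pathWeight_ne_zero p es k hne' he'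
          rw [Function.update_of_ne hne'] at hye'
          exact hwh e' hpe' hye'

/-- (HCOV) for the pendant path of any length into a marks / whiskers hub. -/
theorem HCov_pendant_path_hub (p : E → R) (ends : E → Sym2 V) (hp : IsProbVec p) (k : ℕ)
    (vs : ℕ → V) (es : ℕ → E) (h : IsPath p ends o a₁ a₂ a₃ b k vs es) (h0 : vs 0 = a₃)
    (hleaf : ∀ e, p e ≠ 0 → a₃ ∈ ends e → e = es 0)
    (hu : ∀ e, p e ≠ 0 → vs k ∈ ends e → e = es (k - 1) ∨
      ends e = s(vs k, a₁) ∨ ends e = s(vs k, a₂) ∨ ends e = s(vs k, o) ∨ ends e = s(vs k, b) ∨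
      ∃ y, ends e = s(vs k, y) ∧ y ≠ vs k ∧ y ≠ o ∧ y ≠ a₁ ∧ y ≠ a₂ ∧ y ≠ a₃ ∧ y ≠ b ∧
        ∀ e', p e' ≠ 0 → y ∈ ends e' → e' = e)
    (h3o : a₃ ≠ o) (h31 : a₃ ≠ a₁) (h32 : a₃ ≠ a₂) (h3b : a₃ ≠ b)
    (hu1 : vs k ≠ a₁) (hu2 : vs k ≠ a₂) (huo : vs k ≠ o) (hub : vs k ≠ b) :
    HCov p ends o a₁ a₂ a₃ b :=
  HCov_of_HMF p hp ends o a₁ a₂ a₃ b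
    (HMF_pendant_path_hub p ends hp k vs es h h0 hleaf hu h3o h31 h32 h3b hu1 hu2 huo hub)

end PathHub

end Skeleton

end Summit.Ventures.PercRepro2
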